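import Literature.Probability.Percolation.ArmEventsInterface
import Literature.Probability.Percolation.AltFourArmOfInterfaces
import HarnessLib

/-!
# Four alternating arms force one interface loop to cross the annulus four times

Topic: Probability / Percolation. Proof-only file, the converse direction of the lattice dictionary
between the alternating four-arm event `altFourArm r R` (`AltFourArm.lean`, cluster form) and
crossings of the annulus by percolation interfaces, serving the named fact
`Literature.Probability.Percolation.fourArm_exponent` (Smirnov–Werner 2001, Thm. 4, `j = 4`)
through the loop route to its continuum input (16)₄ (`AltFourArmOfInterfaces.lean`,
`AltFourArmOfCrossingLoops.lean`: interface crossings ⇒ arms; `AltFourArmLiminfFromLoops.lean`: the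
portmanteau lower half). It is the four-arm version of
`exists_interfaceWalk_of_mem_armEvent_two` (`ArmEventsInterface.lean`), by the same
Jordan-curve-free winding argument:

* `exists_loop_four_darts_of_mem_altFourArm` — **the interface loop of the modified configuration
  through the start of one closed arm also passes the start of the other closed arm and the ends
  of both open arms.** Modify `ω` off the annulus as in the two-arm proof: `ω₁` is open on `Λ̊_r`,
  equal to `ω` on the annulus and closed off `Λ_R`. The loop `w` of `ω₁` through the dart
  `s₁ → x₁` (`x₁` the start of the closed arm `1`, `s₁ ∼ x₁` of norm `r - 1`) winds `1` about the
  open inner ball, hence about the ends `y₀, y₂` of the open arms (open transport), and `0` about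
  the closed arms and the outside, hence about `x₃` and about the outer neighbours `z₀, z₂` of
  `y₀, y₂`; so `w` crosses the edges `y₀ z₀`, `y₂ z₂` and `s₃ x₃`
  (`loopWind_triMeshPoint_eq_of_adj`).
* `exists_outer_dart_between` — **between the two inner darts, in either direction along the
  loop, the loop leaves `Λ_R`**: otherwise the closed sites on the right of the darts in between
  form a closed path of the annulus from `x₁` to `x₃`, contradicting the cluster-form clause of
  `altFourArm` that the two closed arms lie in distinct closed clusters of the annulus
  (`pathIn_of_chain`, `rv_succ_eq_or_adj`).
* `exists_loop_inner_outer_pattern_of_mem_altFourArm` — hence along `w`: an inner dart (index `0`),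
  an outer dart, an inner dart, an outer dart, in this cyclic order — four crossings of the
  annulus by one interface loop of `ω₁`; `exists_last_first` then cuts out, between consecutive
  such darts, four stretches all of whose crossed sites lie in the annulus `{r ≤ |·|_𝕋 ≤ R}`,
  where `ω₁ = ω` (`exists_four_annulus_stretches_of_mem_altFourArm`), i.e. four dart-disjoint
  interface walks of `ω` across the annulus.

Everything is proved; no definitions and no named facts are introduced.

## References

* S. Smirnov, W. Werner, Math. Res. Lett. 8 (2001), §4, Remark 6 and (15) ("for even `j` …
  `b_j ≤ const b_j^{ep}`") [SmirnovWernerMRL2001].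
* C. Garban, G. Pete, O. Schramm, J. Amer. Math. Soc. 26 (2013), §2.4 (arms and interfaces)
  [GarbanPeteSchramm2013Pivotal].
* F. Camia, C. M. Newman, Comm. Math. Phys. 268 (2006), §4 [CamiaNewman2006].
* B. Bollobás, O. Riordan, *Percolation* (2006), Ch. 7 p. 178 (the interface graph)
  [BollobasRiordan2006].

Tree: `exists_isSiteInterfaceLoop_of_adj`, `IsSiteInterfaceLoop.loopWind_eq_of_pathIn(_compl)`,
`loopWind_triMeshPoint_eq_zero_of_lt_norm`, `exists_polyTrace_subset_closedBall`,
`IsSiteInterfaceLoop.loopWind_leftPt_sub_loopWind_rightPt`, `loopWind_triMeshPoint_eq_of_adj/_of_mem/_of_not_mem`,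
`exists_triGraph_adj_triNorm_add_one_eq`, `exists_triGraph_adj_triNorm_eq_add_one`,
`exists_pathIn_triNorm_eq_add`, `pathIn_zero_of_triNorm_lt`, `eq_of_triEdgeFaces_eq`
(`ArmEventsInterface.lean`, `SiteInterfaceWinding.lean`), `altFourArm` (`AltFourArm.lean`),
`pathIn_of_chain` (`AltFourArmOfInterfaces.lean`), `IsSiteInterfaceLoop.rv_succ_eq_or_adj`,
`rv_mem_hexFaceVertices(_succ)`, `adj_of_mem_hexFaceVertices`.
-/

noncomputable section

open Set Metric Complex Filter MeasureTheory
open Literature.Topology.PlaneTopology Literature.Probability.RandomPlanarGeometry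
open scoped Topology

namespace Literature.Probability.Percolation

open LatticeModels

/-! ### A combinatorial lemma: last occurrence before the first occurrence -/

/-- **Cutting out a clean stretch.** If `P a` and `Q b` with `a < b`, there are `a ≤ j₁ < j₂ ≤ b`
with `P j₁`, `Q j₂` and neither `P` nor `Q` strictly in between (`j₂` the first index after `a`
with `Q`, `j₁` the last index before `j₂` with `P`). [folklore] -/
theorem exists_last_first (P Q : ℕ → Prop) {a b : ℕ} (hab : a < b) (ha : P a) (hb : Q b) :
    ∃ j₁ j₂, a ≤ j₁ ∧ j₁ < j₂ ∧ j₂ ≤ b ∧ P j₁ ∧ Q j₂ ∧ ∀ j, j₁ < j → j < j₂ → ¬ P j ∧ ¬ Q j := by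
  classical
  -- first `Q` after `a`
  have hex : ∃ j, a < j ∧ Q j := ⟨b, hab, hb⟩
  set j₂ := Nat.find hex with hj₂
  obtain ⟨haj₂, hQ⟩ : a < j₂ ∧ Q j₂ := Nat.find_spec hex
  have hj₂min : ∀ j, a < j → j < j₂ → ¬ Q j := fun j h1 h2 hq ↦ Nat.find_min hex h2 ⟨h1, hq⟩
  have hj₂b : j₂ ≤ b := Nat.find_min' hex ⟨hab, hb⟩
  -- last `P` before `j₂`
  set j₁ := Nat.findGreatest P (j₂ - 1) with hj₁
  have hj₁le : j₁ ≤ j₂ - 1 := Nat.findGreatest_le _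
  have haj₁ : a ≤ j₁ := Nat.le_findGreatest (by omega) ha
  have hP : P j₁ := Nat.findGreatest_spec (P := P) (show a ≤ j₂ - 1 by omega) ha
  have hj₁max : ∀ j, j₁ < j → j ≤ j₂ - 1 → ¬ P j := fun j h1 h2 ↦ Nat.findGreatest_is_greatest h1 h2
  refine ⟨j₁, j₂, haj₁, by omega, hj₂b, hP, hQ, fun j h1 h2 ↦ ⟨hj₁max j h1 (by omega), hj₂min j (by omega) h2⟩⟩

/-! ### The modified configuration -/

section Modified

variable (ω : SiteConfig (Site 2)) (r R : ℕ)

/-- The modified configuration of the two-arm proof is finite. [folklore] -/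
theorem finite_modConfig : ({v : Site 2 | triNorm v < r ∨ (v ∈ ω ∧ triNorm v ≤ R)} : Set (Site 2)).Finite :=
  (triBall R ∪ triBall r).finite_toSet.subset fun v hv ↦ by
    rcases hv with hv | hv
    · exact Finset.mem_coe.2 (Finset.mem_union.2 (Or.inr (mem_triBall_iff.2 hv.le)))
    · exact Finset.mem_coe.2 (Finset.mem_union.2 (Or.inl (mem_triBall_iff.2 hv.2)))

/-- The modified configuration agrees with `ω` on the annulus. [folklore] -/
theorem mem_modConfig_iff_of_mem_ann {v : Site 2} (hv : (r : ℤ) ≤ triNorm v ∧ triNorm v ≤ R) :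
    v ∈ ({v : Site 2 | triNorm v < r ∨ (v ∈ ω ∧ triNorm v ≤ R)} : Set (Site 2)) ↔ v ∈ ω := by
  constructor
  · rintro (h | h)
    · omega
    · exact h.1
  · exact fun h ↦ Or.inr ⟨h, hv.2⟩

end Modified

/-! ### The loop through the start of a closed arm crosses four special edges -/

/-- **Four alternating arms: the interface loop of the modified configuration through the start of
the first closed arm also crosses the start of the second closed arm and the ends of the two open
arms.** For `ω ∈ altFourArm r R` (`1 ≤ r ≤ R`), with `ω₁ = {|·| < r} ∪ (ω ∩ {|·| ≤ R})`, there are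
an interface loop `w` of `ω₁` and indices `i₀, i₂, i₃ < n` such that: dart `0` of `w` is
`s₁ → x₁` and dart `i₃` is `s₃ → x₃`, where `x₁`, `x₃` are sites of the two closed arms (of norm
`r`) and `s₁`, `s₃` have norm `r - 1`; darts `i₀`, `i₂` are `y₀ → z₀`, `y₂ → z₂` with `y₀`, `y₂`
the ends of the open arms (norm `R`) and `z₀`, `z₂` of norm `R + 1`. Moreover no closed path of
the annulus `{r ≤ |·| ≤ R}` joins `x₁` to `x₃`. Proof: winding numbers, as in
`exists_interfaceWalk_of_mem_armEvent_two`. [cite: SmirnovWernerMRL2001, §4 Remark 6 and (15)] [cite: CamiaNewman2006, §4] -/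
theorem exists_loop_four_darts_of_mem_altFourArm {ω : SiteConfig (Site 2)} {r R : ℕ} (hr : 1 ≤ r) (hrR : r ≤ R)
    (hω : ω ∈ altFourArm r R) :
    ∃ (F₀ : HexVertex) (w : hexGraph.Walk F₀ F₀)
      (hw : IsSiteInterfaceLoop {v : Site 2 | triNorm v < r ∨ (v ∈ ω ∧ triNorm v ≤ R)} w) (i₀ i₂ i₃ : ℕ),
      i₀ < w.length ∧ i₂ < w.length ∧ i₃ < w.length ∧ 0 < w.length ∧
      triNorm (hw.lv 0) + 1 = r ∧ triNorm (hw.rv 0) = r ∧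
      triNorm (hw.lv i₃) + 1 = r ∧ triNorm (hw.rv i₃) = r ∧
      triNorm (hw.lv i₀) = R ∧ triNorm (hw.rv i₀) = R + 1 ∧
      triNorm (hw.lv i₂) = R ∧ triNorm (hw.rv i₂) = R + 1 ∧
      hw.rv 0 ≠ hw.rv i₃ ∧ hw.lv i₀ ≠ hw.lv i₂ ∧
      ¬ PathIn triGraph (triAnn r R \ ω) (hw.rv 0) (hw.rv i₃) := by
  classical
  -- the four arms
  obtain ⟨x, y, wa, hwa, hdisj, hoo, hcc⟩ := hω
  have hxn : ∀ j, triNorm (x j) = r := fun j ↦ mem_triSphere_iff.1 (hwa j).1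
  have hyn : ∀ j, triNorm (y j) = R := fun j ↦ mem_triSphere_iff.1 (hwa j).2.1
  have hsuppAnn : ∀ j, ∀ v ∈ (wa j).support, (r : ℤ) ≤ triNorm v ∧ triNorm v ≤ R := by
    intro j v hv
    rcases (hwa j).2.2.2.1 v hv with h | h
    · simp only [Set.mem_sdiff, Finset.mem_coe, mem_triBall_iff, not_le] at h
      exact ⟨by omega, h.1⟩
    · rw [mem_triSphere_iff] at h; omega
  have hcol : ∀ j, ∀ v ∈ (wa j).support, (v ∈ ω ↔ (![true, false, true, false] : Fin 4 → Bool) j = true) :=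
    fun j v hv ↦ (hwa j).2.2.2.2 v hv
  -- the modified configuration: open inside `Λ̊_r`, `ω` on the annulus, closed off `Λ_R`
  set ω₁ : SiteConfig (Site 2) := {v | triNorm v < r ∨ (v ∈ ω ∧ triNorm v ≤ R)} with hω₁
  have hin : ∀ v, triNorm v < r → v ∈ ω₁ := fun v hv ↦ Or.inl hv
  have hout : ∀ v, (R : ℤ) < triNorm v → v ∈ ω₁ᶜ := fun v hv h ↦ by
    rcases h with h | h <;> omega
  have hfin : ω₁.Finite := finite_modConfig ω r R
  -- the arms inside `ω₁`: open arms as open paths, closed arms as closed paths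
  have hPo : ∀ j, (![true, false, true, false] : Fin 4 → Bool) j = true → PathIn triGraph ω₁ (x j) (y j) := by
    intro j hj
    refine PathIn.of_walk (wa j) fun v hv ↦ Or.inr ⟨(hcol j v hv).2 hj, (hsuppAnn j v hv).2⟩
  have hPc : ∀ j, (![true, false, true, false] : Fin 4 → Bool) j = false → PathIn triGraph ω₁ᶜ (x j) (y j) := by
    intro j hj
    refine PathIn.of_walk (wa j) fun v hv h ↦ ?_
    rcases h with h | h
    · exact absurd (hsuppAnn j v hv).1 (not_le.2 h)
    · have := (hcol j v hv).1 h.1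
      rw [hj] at this
      exact Bool.false_ne_true this
  have hPo0 := hPo 0 rfl
  have hPo2 := hPo 2 rfl
  have hPc1 := hPc 1 rfl
  have hPc3 := hPc 3 rfl
  -- inward neighbours of the starting points, outward neighbours of the endpoints
  have hx0 : ∀ j, x j ≠ 0 := by intro j h; have := hxn j; rw [h, triNorm_zero] at this; omega
  obtain ⟨s₁, hxs₁, hs₁⟩ := exists_triGraph_adj_triNorm_add_one_eq (hx0 1)
  obtain ⟨s₃, hxs₃, hs₃⟩ := exists_triGraph_adj_triNorm_add_one_eq (hx0 3)
  obtain ⟨s₀, hxs₀, hs₀⟩ := exists_triGraph_adj_triNorm_add_one_eq (hx0 0)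
  obtain ⟨s₂, hxs₂, hs₂⟩ := exists_triGraph_adj_triNorm_add_one_eq (hx0 2)
  obtain ⟨z₀, hyz₀, hz₀⟩ := exists_triGraph_adj_triNorm_eq_add_one (y 0)
  obtain ⟨z₂, hyz₂, hz₂⟩ := exists_triGraph_adj_triNorm_eq_add_one (y 2)
  obtain ⟨z₁, hyz₁, hz₁⟩ := exists_triGraph_adj_triNorm_eq_add_one (y 1)
  obtain ⟨z₃, hyz₃, hz₃⟩ := exists_triGraph_adj_triNorm_eq_add_one (y 3)
  have hx1n := hxn 1; have hx3n := hxn 3; have hx0n := hxn 0; have hx2n := hxn 2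
  have hy0n := hyn 0; have hy2n := hyn 2; have hy1n := hyn 1; have hy3n := hyn 3
  have hs₁ω : s₁ ∈ ω₁ := hin _ (by omega)
  have hs₃ω : s₃ ∈ ω₁ := hin _ (by omega)
  have hx₁ω : x 1 ∉ ω₁ := hPc1.left_mem
  have hx₃ω : x 3 ∉ ω₁ := hPc3.left_mem
  -- the interface loop of `ω₁` through the dart `s₁ → x₁`
  obtain ⟨F₀, w, hw, hfaces⟩ := exists_isSiteInterfaceLoop_of_adj hfin hxs₁.symm hs₁ω hx₁ω
  have hlen : 0 < w.length := by have := hw.isCycle.three_le_length; omega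
  have hlr : hw.lv 0 = s₁ ∧ hw.rv 0 = x 1 := by
    obtain ⟨h', hfaces', -, -⟩ := hw.dart_spec hlen
    exact eq_of_triEdgeFaces_eq h' hxs₁.symm (hfaces'.trans hfaces.symm)
  -- winding numbers of the interface polygon at mesh `1` about the sites
  obtain ⟨ρ, hρ⟩ := exists_polyTrace_subset_closedBall hlen (1 : ℝ)
  have hWout : ∀ v, (R : ℤ) < triNorm v → loopWind 1 w (triMeshPoint 1 v) = 0 := by
    intro v hv
    obtain ⟨k, hk⟩ := exists_nat_gt (2 * ρ)
    obtain ⟨u, hu, hp⟩ := exists_pathIn_triNorm_eq_add hout hv k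
    have hWu : loopWind 1 w (triMeshPoint 1 u) = 0 := by
      refine loopWind_triMeshPoint_eq_zero_of_lt_norm one_pos hlen hρ ?_
      have h1 := mul_triNorm_le_norm_triEmbed u
      have h2 : (k : ℝ) ≤ triNorm u := by
        have : (k : ℤ) ≤ triNorm u := by rw [hu]; have := triNorm_nonneg v; omega
        exact_mod_cast this
      have h3 : (1 : ℝ) ≤ Real.sqrt 3 := Real.one_le_sqrt.2 (by norm_num)
      have h4 : (0 : ℝ) ≤ triNorm u := by exact_mod_cast triNorm_nonneg u
      nlinarith
    rw [← hWu]
    exact hw.loopWind_eq_of_pathIn_compl one_pos subset_rfl hp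
  -- the closed arms have winding number `0`
  have hWx : ∀ j, PathIn triGraph ω₁ᶜ (x j) (y j) → ∀ {z : Site 2}, triGraph.Adj (y j) z → triNorm z = triNorm (y j) + 1 →
      loopWind 1 w (triMeshPoint 1 (x j)) = 0 := by
    intro j hP z hyz hz
    have hyj := hyn j
    rw [hw.loopWind_eq_of_pathIn_compl one_pos subset_rfl hP,
      hw.loopWind_triMeshPoint_eq_of_not_mem one_pos (Or.inr hyz) hP.right_mem (hout z (by omega))]
    exact hWout z (by omega)
  have hWx₁ : loopWind 1 w (triMeshPoint 1 (x 1)) = 0 := hWx 1 hPc1 hyz₁ hz₁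
  have hWx₃ : loopWind 1 w (triMeshPoint 1 (x 3)) = 0 := hWx 3 hPc3 hyz₃ hz₃
  -- the open side has winding number `1`
  have hjump := hw.loopWind_leftPt_sub_loopWind_rightPt one_pos hlen
  rw [IsSiteInterfaceLoop.leftPt, IsSiteInterfaceLoop.rightPt, hlr.1, hlr.2, hWx₁] at hjump
  have hWs₁ : loopWind 1 w (triMeshPoint 1 s₁) = 1 := by omega
  -- transport through the open inner ball
  have hW0 : loopWind 1 w (triMeshPoint 1 s₁) = loopWind 1 w (triMeshPoint 1 (0 : Site 2)) :=
    hw.loopWind_eq_of_pathIn one_pos subset_rfl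
      (pathIn_zero_of_triNorm_lt hin (r - 1) s₁ (by push_cast [hr]; omega) (by push_cast [hr]; omega))
  have hWball : ∀ s : Site 2, triNorm s + 1 = r → loopWind 1 w (triMeshPoint 1 s) = 1 := by
    intro s hs
    rw [← hWs₁, hW0]
    exact hw.loopWind_eq_of_pathIn one_pos subset_rfl
      (pathIn_zero_of_triNorm_lt hin (r - 1) s (by push_cast [hr]; omega) (by push_cast [hr]; omega))
  have hWs₃ : loopWind 1 w (triMeshPoint 1 s₃) = 1 := hWball s₃ (hs₃.trans hx3n)
  have hWy : ∀ j, PathIn triGraph ω₁ (x j) (y j) → ∀ {s : Site 2}, triGraph.Adj (x j) s → triNorm s + 1 = triNorm (x j) →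
      loopWind 1 w (triMeshPoint 1 (y j)) = 1 := by
    intro j hP s hxs hs
    have hxj := hxn j
    rw [← hWball s (hs.trans hxj), hw.loopWind_triMeshPoint_eq_of_mem one_pos (Or.inr hxs.symm) (hin s (by have := hxn j; omega)) hP.left_mem,
      hw.loopWind_eq_of_pathIn one_pos subset_rfl hP]
  have hWy₀ : loopWind 1 w (triMeshPoint 1 (y 0)) = 1 := hWy 0 hPo0 hxs₀ hs₀
  have hWy₂ : loopWind 1 w (triMeshPoint 1 (y 2)) = 1 := hWy 2 hPo2 hxs₂ hs₂
  have hWz₀ : loopWind 1 w (triMeshPoint 1 z₀) = 0 := hWout z₀ (by omega)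
  have hWz₂ : loopWind 1 w (triMeshPoint 1 z₂) = 0 := hWout z₂ (by omega)
  -- so the loop crosses the edges `y₀ z₀`, `y₂ z₂` and `s₃ x₃`
  have hcrossOut : ∀ {a b : Site 2}, triGraph.Adj a b → loopWind 1 w (triMeshPoint 1 a) = 1 →
      loopWind 1 w (triMeshPoint 1 b) = 0 → (R : ℤ) < triNorm b → ∃ i < w.length, hw.lv i = a ∧ hw.rv i = b := by
    intro a b hab hWa hWb hb
    by_contra hno
    push Not at hno
    have := hw.loopWind_triMeshPoint_eq_of_adj one_pos (Or.inr hab) fun i hi ↦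
      ⟨fun hh ↦ hno i hi hh.1.symm hh.2.symm, fun hh ↦ hout b hb (hh.2 ▸ hw.lv_mem hi)⟩
    rw [hWa, hWb] at this
    exact one_ne_zero this
  obtain ⟨i₀, hi₀, hl₀, hr₀⟩ := hcrossOut hyz₀ hWy₀ hWz₀ (by omega)
  obtain ⟨i₂, hi₂, hl₂, hr₂⟩ := hcrossOut hyz₂ hWy₂ hWz₂ (by omega)
  have hcross₃ : ∃ i < w.length, hw.lv i = s₃ ∧ hw.rv i = x 3 := by
    by_contra hno
    push Not at hno
    have := hw.loopWind_triMeshPoint_eq_of_adj one_pos (Or.inr hxs₃.symm) fun i hi ↦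
      ⟨fun hh ↦ hno i hi hh.1.symm hh.2.symm, fun hh ↦ hx₃ω (hh.2 ▸ hw.lv_mem hi)⟩
    rw [hWs₃, hWx₃] at this
    exact one_ne_zero this
  obtain ⟨i₃, hi₃, hl₃, hr₃⟩ := hcross₃
  -- distinctness of the special sites from disjointness of the arms
  have hx13 : x 1 ≠ x 3 := by
    intro h
    have h3 : x 1 ∈ (wa 3).support := by rw [h]; exact (wa 3).start_mem_support
    exact Finset.disjoint_left.1 (hdisj (show (1 : Fin 4) ≠ 3 by decide))
      (List.mem_toFinset.2 ((wa 1).start_mem_support)) (List.mem_toFinset.2 h3)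
  have hy02 : y 0 ≠ y 2 := by
    intro h
    have h2 : y 0 ∈ (wa 2).support := by rw [h]; exact (wa 2).end_mem_support
    exact Finset.disjoint_left.1 (hdisj (show (0 : Fin 4) ≠ 2 by decide))
      (List.mem_toFinset.2 ((wa 0).end_mem_support)) (List.mem_toFinset.2 h2)
  refine ⟨F₀, w, hw, i₀, i₂, i₃, hi₀, hi₂, hi₃, hlen, ?_, ?_, ?_, ?_, ?_, ?_, ?_, ?_, ?_, ?_, ?_⟩
  · rw [hlr.1]; omega
  · rw [hlr.2]; exact hx1n
  · rw [hl₃]; omega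
  · rw [hr₃]; exact hx3n
  · rw [hl₀]; exact hy0n
  · rw [hr₀, hz₀, hy0n]
  · rw [hl₂]; exact hy2n
  · rw [hr₂, hz₂, hy2n]
  · rw [hlr.2, hr₃]; exact hx13
  · rw [hl₀, hl₂]; exact hy02
  · rw [hlr.2, hr₃]
    exact hcc (x 1) (wa 1).start_mem_support (x 3) (wa 3).start_mem_support

/-! ### Between the two inner darts the loop leaves the outer hexagon -/

/-- **The closed sites on the right of a stretch of darts form a path.** For an interface loop and
indices `a ≤ b < n`, `rv a` is joined to `rv b` by a path inside `{rv k | a ≤ k ≤ b}` (consecutive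
right sites are equal or adjacent, `rv_succ_eq_or_adj`). [folklore] -/
theorem IsSiteInterfaceLoop.pathIn_rv {ξ : SiteConfig (Site 2)} {F₀ : HexVertex} {w : hexGraph.Walk F₀ F₀}
    (hw : IsSiteInterfaceLoop ξ w) {a b : ℕ} (hab : a ≤ b) (hb : b < w.length) :
    PathIn triGraph {v | ∃ k, a ≤ k ∧ k ≤ b ∧ v = hw.rv k} (hw.rv a) (hw.rv b) := by
  have h := pathIn_of_chain (fun p ↦ hw.rv (a + p)) (b - a) fun p hp ↦ by
    rcases hw.rv_succ_eq_or_adj (i := a + p) (by omega) with h | h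
    · exact Or.inl (by rw [show a + (p + 1) = a + p + 1 by omega]; exact h.symm)
    · exact Or.inr (by rw [show a + (p + 1) = a + p + 1 by omega]; exact h)
  rw [show a + (b - a) = b by omega, Nat.add_zero] at h
  refine h.mono ?_
  rintro v ⟨p, hp, rfl⟩
  exact ⟨a + p, by omega, by omega, rfl⟩

/-- **Outer excursion between the inner darts, forward.** In the setting of
`exists_loop_four_darts_of_mem_altFourArm`: if darts `a < b` of the loop of `ω₁` have right sites
`rv a`, `rv b` not joined by a closed path of the annulus `{r ≤ |·| ≤ R}` of `ω`, then some dart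
strictly between them has its right site off `Λ_R` (the right sites in between are closed sites of
`ω₁`, hence of norm `≥ r`, and those of norm `≤ R` are closed sites of `ω` in the annulus:
`pathIn_rv` would join `rv a` to `rv b`). [cite: SmirnovWernerMRL2001, §4 Remark 6 and (15)] -/
theorem exists_outer_dart_between {ω : SiteConfig (Site 2)} {r R : ℕ} {F₀ : HexVertex} {w : hexGraph.Walk F₀ F₀}
    (hw : IsSiteInterfaceLoop {v : Site 2 | triNorm v < r ∨ (v ∈ ω ∧ triNorm v ≤ R)} w)
    {a b : ℕ} (hab : a < b) (hb : b < w.length) (haR : triNorm (hw.rv a) ≤ R) (hbR : triNorm (hw.rv b) ≤ R)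
    (hsep : ¬ PathIn triGraph (triAnn r R \ ω) (hw.rv a) (hw.rv b)) :
    ∃ j, a < j ∧ j < b ∧ (R : ℤ) < triNorm (hw.rv j) := by
  by_contra hno
  push Not at hno
  apply hsep
  refine (hw.pathIn_rv hab.le hb).mono ?_
  rintro v ⟨k, hak, hkb, rfl⟩
  have hk : k < w.length := by omega
  have hclosed : hw.rv k ∉ ({v : Site 2 | triNorm v < r ∨ (v ∈ ω ∧ triNorm v ≤ R)} : Set (Site 2)) := hw.rv_not_mem hk
  have hnorm_r : (r : ℤ) ≤ triNorm (hw.rv k) := by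
    by_contra h; exact hclosed (Or.inl (by omega))
  have hnorm_R : triNorm (hw.rv k) ≤ R := by
    rcases Nat.lt_or_ge a k with h1 | h1
    · rcases Nat.lt_or_ge k b with h2 | h2
      · exact hno k h1 h2
      · obtain rfl : k = b := le_antisymm hkb h2
        exact hbR
    · obtain rfl : k = a := le_antisymm h1 hak
      exact haR
  exact ⟨mem_triAnn.2 ⟨hnorm_r, hnorm_R⟩, fun h ↦ hclosed (Or.inr ⟨h, hnorm_R⟩)⟩

/-- **Outer excursion after the second inner dart, around the base point.** Same as
`exists_outer_dart_between` for the arc from dart `a` back to dart `0` (the right sites of darts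
`n - 1` and `0` are vertices of the base face, hence equal or adjacent). [cite: SmirnovWernerMRL2001, §4 Remark 6 and (15)] -/
theorem exists_outer_dart_after {ω : SiteConfig (Site 2)} {r R : ℕ} {F₀ : HexVertex} {w : hexGraph.Walk F₀ F₀}
    (hw : IsSiteInterfaceLoop {v : Site 2 | triNorm v < r ∨ (v ∈ ω ∧ triNorm v ≤ R)} w)
    {a : ℕ} (ha : a < w.length) (haR : triNorm (hw.rv a) ≤ R) (h0R : triNorm (hw.rv 0) ≤ R)
    (hsep : ¬ PathIn triGraph (triAnn r R \ ω) (hw.rv a) (hw.rv 0)) :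
    ∃ j, a < j ∧ j < w.length ∧ (R : ℤ) < triNorm (hw.rv j) := by
  by_contra hno
  push Not at hno
  apply hsep
  -- the chain `rv a, …, rv (n-1), rv 0`
  set c : ℕ → Site 2 := fun p ↦ if a + p < w.length then hw.rv (a + p) else hw.rv 0 with hc
  have hcv : ∀ p, c p = if a + p < w.length then hw.rv (a + p) else hw.rv 0 := fun p ↦ rfl
  have hcN : c (w.length - a) = hw.rv 0 := by rw [hcv, if_neg (by omega)]
  have hc0 : c 0 = hw.rv a := by rw [hcv, if_pos (by omega), Nat.add_zero]
  have hpath := pathIn_of_chain c (w.length - a) fun p hp ↦ by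
    by_cases h1 : a + p + 1 < w.length
    · have e1 : c p = hw.rv (a + p) := by rw [hcv, if_pos (by omega)]
      have e2 : c (p + 1) = hw.rv (a + p + 1) := by
        rw [hcv, if_pos (by omega), show a + (p + 1) = a + p + 1 by omega]
      rw [e1, e2]
      rcases hw.rv_succ_eq_or_adj (i := a + p) h1 with h | h
      exacts [Or.inl h.symm, Or.inr h]
    · -- last step: `rv (n-1)` and `rv 0` are vertices of the base face
      have e0 : a + p + 1 = w.length := by omega
      have e1 : c p = hw.rv (a + p) := by rw [hcv, if_pos (by omega)]
      have e2 : c (p + 1) = hw.rv 0 := by rw [hcv, if_neg (by omega)]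
      rw [e1, e2]
      have h1 : hw.rv (a + p) ∈ hexFaceVertices (w.getVert (a + p + 1)) := hw.rv_mem_hexFaceVertices_succ (by omega)
      rw [e0, SimpleGraph.Walk.getVert_length] at h1
      have h2 : hw.rv 0 ∈ hexFaceVertices (w.getVert 0) := hw.rv_mem_hexFaceVertices (by omega)
      rw [SimpleGraph.Walk.getVert_zero] at h2
      by_cases heq : hw.rv (a + p) = hw.rv 0
      · exact Or.inl heq
      · exact Or.inr (adj_of_mem_hexFaceVertices h1 h2 heq)
  rw [hc0, hcN] at hpath
  refine hpath.mono ?_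
  rintro v ⟨p, hp, rfl⟩
  -- every site of the chain is a right site `rv k` with `k = a + p < n` or `k = 0`
  obtain ⟨k, hk, hka, hck⟩ : ∃ k, k < w.length ∧ (k = 0 ∨ a ≤ k) ∧ c p = hw.rv k := by
    by_cases h : a + p < w.length
    · exact ⟨a + p, h, Or.inr (by omega), by rw [hcv, if_pos h]⟩
    · exact ⟨0, by omega, Or.inl rfl, by rw [hcv, if_neg h]⟩
  rw [hck]
  have hclosed : hw.rv k ∉ ({v : Site 2 | triNorm v < r ∨ (v ∈ ω ∧ triNorm v ≤ R)} : Set (Site 2)) := hw.rv_not_mem hk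
  have hnorm_r : (r : ℤ) ≤ triNorm (hw.rv k) := by
    by_contra h'; exact hclosed (Or.inl (by omega))
  have hnorm_R : triNorm (hw.rv k) ≤ R := by
    rcases hka with rfl | hka
    · exact h0R
    · rcases eq_or_lt_of_le hka with rfl | hlt
      · exact haR
      · exact hno k hlt hk
  exact ⟨mem_triAnn.2 ⟨hnorm_r, hnorm_R⟩, fun h' ↦ hclosed (Or.inr ⟨h', hnorm_R⟩)⟩

/-! ### The cyclic pattern inner–outer–inner–outer -/

/-- **Four alternating arms force one interface loop of the modified configuration to cross the
annulus four times**: there are an interface loop `w` of `ω₁ = {|·| < r} ∪ (ω ∩ {|·| ≤ R})` and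
indices `0 < d₀ < i₃ < d₁ < n` such that darts `0` and `i₃` point from a site of norm `r - 1` to a
site of norm `r` and darts `d₀`, `d₁` have their right site off `Λ_R`. [cite: SmirnovWernerMRL2001, §4 Remark 6 and (15)] [cite: GarbanPeteSchramm2013Pivotal, §2.4] -/
theorem exists_loop_inner_outer_pattern_of_mem_altFourArm {ω : SiteConfig (Site 2)} {r R : ℕ} (hr : 1 ≤ r)
    (hrR : r ≤ R) (hω : ω ∈ altFourArm r R) :
    ∃ (F₀ : HexVertex) (w : hexGraph.Walk F₀ F₀)
      (hw : IsSiteInterfaceLoop {v : Site 2 | triNorm v < r ∨ (v ∈ ω ∧ triNorm v ≤ R)} w) (d₀ i₃ d₁ : ℕ),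
      0 < d₀ ∧ d₀ < i₃ ∧ i₃ < d₁ ∧ d₁ < w.length ∧
      triNorm (hw.lv 0) + 1 = r ∧ triNorm (hw.rv 0) = r ∧
      triNorm (hw.lv i₃) + 1 = r ∧ triNorm (hw.rv i₃) = r ∧
      (R : ℤ) < triNorm (hw.rv d₀) ∧ (R : ℤ) < triNorm (hw.rv d₁) := by
  obtain ⟨F₀, w, hw, i₀, i₂, i₃, hi₀, hi₂, hi₃, hlen, hl0, hr0, hl3, hr3, hl0', hr0', hl2', hr2', hx13, hy02, hsep⟩ :=
    exists_loop_four_darts_of_mem_altFourArm hr hrR hω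
  have hi₃0 : 0 < i₃ := by
    rw [Nat.pos_iff_ne_zero]; rintro rfl; exact hx13 rfl
  have hrR' : (r : ℤ) ≤ R := by exact_mod_cast hrR
  obtain ⟨d₀, hd₀0, hd₀i, hd₀R⟩ := exists_outer_dart_between hw hi₃0 hi₃ (by rw [hr0]; exact hrR') (by rw [hr3]; exact hrR') hsep
  obtain ⟨d₁, hd₁i, hd₁n, hd₁R⟩ := exists_outer_dart_after hw hi₃ (by rw [hr3]; exact hrR') (by rw [hr0]; exact hrR')
    (fun h ↦ hsep h.symm)
  exact ⟨F₀, w, hw, d₀, i₃, d₁, hd₀0, hd₀i, hd₁i, hd₁n, hl0, hr0, hl3, hr3, hd₀R, hd₁R⟩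

/-! ### Four clean stretches across the annulus -/

/-- **Four alternating arms force four dart-disjoint stretches of one interface loop across the
annulus.** For `ω ∈ altFourArm r R` (`1 ≤ r ≤ R`) there are an interface loop `w` of the modified
configuration `ω₁ = {|·| < r} ∪ (ω ∩ {|·| ≤ R})` and indices
`a₀ < b₀ ≤ a₁ < b₁ ≤ a₂ < b₂ ≤ a₃ < b₃ ≤ n` such that every dart strictly between `aₖ` and `bₖ` has
both its sites in the annulus `{r ≤ |·|_𝕋 ≤ R}` — where `ω₁ = ω`, so its left site is open and
its right site closed in `ω` — and the faces `w.getVert (aₖ + 1)`, `w.getVert bₖ` at the two ends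
have a vertex in `Λ̊_r` and a vertex off `Λ_R`, alternately (`k` even: from `Λ̊_r` to off `Λ_R`;
`k` odd: conversely). These are four dart-disjoint interface walks of `ω` across the
annulus (cf. `exists_interfaceWalk_of_mem_armEvent_two` for two arms). [cite: SmirnovWernerMRL2001, §4 Remark 6 and (15)] [cite: GarbanPeteSchramm2013Pivotal, §2.4] -/
theorem exists_four_annulus_stretches_of_mem_altFourArm {ω : SiteConfig (Site 2)} {r R : ℕ} (hr : 1 ≤ r)
    (hrR : r ≤ R) (hω : ω ∈ altFourArm r R) :
    ∃ (F₀ : HexVertex) (w : hexGraph.Walk F₀ F₀)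
      (hw : IsSiteInterfaceLoop {v : Site 2 | triNorm v < r ∨ (v ∈ ω ∧ triNorm v ≤ R)} w) (a₀ b₀ a₁ b₁ a₂ b₂ a₃ b₃ : ℕ),
      a₀ < b₀ ∧ b₀ ≤ a₁ ∧ a₁ < b₁ ∧ b₁ ≤ a₂ ∧ a₂ < b₂ ∧ b₂ ≤ a₃ ∧ a₃ < b₃ ∧ b₃ ≤ w.length ∧
      (∀ j, (a₀ < j ∧ j < b₀) ∨ (a₁ < j ∧ j < b₁) ∨ (a₂ < j ∧ j < b₂) ∨ (a₃ < j ∧ j < b₃) →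
        ((r : ℤ) ≤ triNorm (hw.lv j) ∧ triNorm (hw.lv j) ≤ R) ∧ ((r : ℤ) ≤ triNorm (hw.rv j) ∧ triNorm (hw.rv j) ≤ R) ∧
        hw.lv j ∈ ω ∧ hw.rv j ∉ ω) ∧
      ((∃ v ∈ hexFaceVertices (w.getVert (a₀ + 1)), triNorm v < r) ∧ ∃ v ∈ hexFaceVertices (w.getVert b₀), (R : ℤ) < triNorm v) ∧
      ((∃ v ∈ hexFaceVertices (w.getVert (a₁ + 1)), (R : ℤ) < triNorm v) ∧ ∃ v ∈ hexFaceVertices (w.getVert b₁), triNorm v < r) ∧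
      ((∃ v ∈ hexFaceVertices (w.getVert (a₂ + 1)), triNorm v < r) ∧ ∃ v ∈ hexFaceVertices (w.getVert b₂), (R : ℤ) < triNorm v) ∧
      ((∃ v ∈ hexFaceVertices (w.getVert (a₃ + 1)), (R : ℤ) < triNorm v) ∧ ∃ v ∈ hexFaceVertices (w.getVert b₃), triNorm v < r) := by
  obtain ⟨F₀, w, hw, d₀, i₃, d₁, hd₀0, hd₀i, hi₃d, hd₁n, hl0, hr0, hl3, hr3, hd₀R, hd₁R⟩ :=
    exists_loop_inner_outer_pattern_of_mem_altFourArm hr hrR hω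
  set n := w.length with hn
  -- inner and outer darts (dart `n` read as dart `0`)
  set In : ℕ → Prop := fun k ↦ triNorm (hw.lv (k % n)) < r ∨ triNorm (hw.rv (k % n)) < r with hIn
  set Out : ℕ → Prop := fun k ↦ (R : ℤ) < triNorm (hw.lv (k % n)) ∨ (R : ℤ) < triNorm (hw.rv (k % n)) with hOut
  have hmod : ∀ {k}, k < n → k % n = k := fun hk ↦ Nat.mod_eq_of_lt hk
  have hIn0 : In 0 := Or.inl (by rw [Nat.zero_mod]; omega)
  have hInn : In n := Or.inl (by rw [Nat.mod_self]; omega)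
  have hIn3 : In i₃ := Or.inl (by rw [hmod (by omega)]; omega)
  have hOut0 : Out d₀ := Or.inr (by rw [hmod (by omega)]; exact hd₀R)
  have hOut1 : Out d₁ := Or.inr (by rw [hmod hd₁n]; exact hd₁R)
  -- the four clean stretches
  obtain ⟨a₀, b₀, ha₀, hab₀, hb₀, hPa₀, hQb₀, hmid₀⟩ := exists_last_first In Out hd₀0 hIn0 hOut0
  obtain ⟨a₁, b₁, ha₁, hab₁, hb₁, hPa₁, hQb₁, hmid₁⟩ := exists_last_first Out In hd₀i hOut0 hIn3
  obtain ⟨a₂, b₂, ha₂, hab₂, hb₂, hPa₂, hQb₂, hmid₂⟩ := exists_last_first In Out hi₃d hIn3 hOut1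
  obtain ⟨a₃, b₃, ha₃, hab₃, hb₃, hPa₃, hQb₃, hmid₃⟩ := exists_last_first Out In hd₁n hOut1 hInn
  -- annulus darts in between
  have hann : ∀ {a' b' : ℕ}, b' ≤ n → (∀ j, a' < j → j < b' → ¬ In j ∧ ¬ Out j ∨ ¬ Out j ∧ ¬ In j) →
      ∀ j, a' < j → j < b' →
        ((r : ℤ) ≤ triNorm (hw.lv j) ∧ triNorm (hw.lv j) ≤ R) ∧ ((r : ℤ) ≤ triNorm (hw.rv j) ∧ triNorm (hw.rv j) ≤ R) ∧
        hw.lv j ∈ ω ∧ hw.rv j ∉ ω := by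
    intro a' b' hb' hmid j h1 h2
    have hj : j < n := by omega
    have hm := hmid j h1 h2
    have hnI : ¬ In j := by rcases hm with h | h; exacts [h.1, h.2]
    have hnO : ¬ Out j := by rcases hm with h | h; exacts [h.2, h.1]
    simp only [hIn, hOut, hmod hj, not_or, not_lt] at hnI hnO
    have hl : ((r : ℤ) ≤ triNorm (hw.lv j) ∧ triNorm (hw.lv j) ≤ R) := ⟨hnI.1, hnO.1⟩
    have hr' : ((r : ℤ) ≤ triNorm (hw.rv j) ∧ triNorm (hw.rv j) ≤ R) := ⟨hnI.2, hnO.2⟩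
    refine ⟨hl, hr', (mem_modConfig_iff_of_mem_ann ω r R hl).1 (hw.lv_mem hj), fun h ↦ ?_⟩
    exact hw.rv_not_mem hj ((mem_modConfig_iff_of_mem_ann ω r R hr').2 h)
  -- faces at the ends: the face after dart `a'` has both sites of dart `a'` as vertices, the face
  -- at `b'` has both sites of dart `b' % n`
  have hfaceA : ∀ {a' : ℕ}, a' < n → hw.lv (a' % n) ∈ hexFaceVertices (w.getVert (a' + 1)) ∧
      hw.rv (a' % n) ∈ hexFaceVertices (w.getVert (a' + 1)) := fun ha' ↦ by
    rw [hmod ha']; exact ⟨hw.lv_mem_hexFaceVertices_succ ha', hw.rv_mem_hexFaceVertices_succ ha'⟩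
  have hfaceB : ∀ {b' : ℕ}, b' ≤ n → hw.lv (b' % n) ∈ hexFaceVertices (w.getVert b') ∧
      hw.rv (b' % n) ∈ hexFaceVertices (w.getVert b') := fun {b'} hb' ↦ by
    rcases Nat.lt_or_ge b' n with h | h
    · rw [hmod h]; exact ⟨hw.lv_mem_hexFaceVertices h, hw.rv_mem_hexFaceVertices h⟩
    · obtain rfl : b' = n := le_antisymm hb' h
      have e : w.getVert n = w.getVert 0 := by
        rw [hn, SimpleGraph.Walk.getVert_length, SimpleGraph.Walk.getVert_zero]
      rw [Nat.mod_self, e]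
      have hlen : 0 < w.length := by omega
      exact ⟨hw.lv_mem_hexFaceVertices hlen, hw.rv_mem_hexFaceVertices hlen⟩
  have hInFace : ∀ {k : ℕ} {F : HexVertex}, In k → hw.lv (k % n) ∈ hexFaceVertices F → hw.rv (k % n) ∈ hexFaceVertices F →
      ∃ v ∈ hexFaceVertices F, triNorm v < r := fun hI hl hr' ↦ by
    rcases hI with h | h; exacts [⟨_, hl, h⟩, ⟨_, hr', h⟩]
  have hOutFace : ∀ {k : ℕ} {F : HexVertex}, Out k → hw.lv (k % n) ∈ hexFaceVertices F → hw.rv (k % n) ∈ hexFaceVertices F →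
      ∃ v ∈ hexFaceVertices F, (R : ℤ) < triNorm v := fun hO hl hr' ↦ by
    rcases hO with h | h; exacts [⟨_, hl, h⟩, ⟨_, hr', h⟩]
  refine ⟨F₀, w, hw, a₀, b₀, a₁, b₁, a₂, b₂, a₃, b₃, hab₀, hb₀.trans ha₁, hab₁, hb₁.trans ha₂, hab₂, hb₂.trans ha₃, hab₃, hb₃,
    fun j hj ↦ ?_, ?_, ?_, ?_, ?_⟩
  · rcases hj with ⟨h1, h2⟩ | ⟨h1, h2⟩ | ⟨h1, h2⟩ | ⟨h1, h2⟩
    · exact hann (show b₀ ≤ n by omega) (fun j h1 h2 ↦ Or.inl (hmid₀ j h1 h2)) j h1 h2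
    · exact hann (show b₁ ≤ n by omega) (fun j h1 h2 ↦ Or.inr (hmid₁ j h1 h2)) j h1 h2
    · exact hann (show b₂ ≤ n by omega) (fun j h1 h2 ↦ Or.inl (hmid₂ j h1 h2)) j h1 h2
    · exact hann hb₃ (fun j h1 h2 ↦ Or.inr (hmid₃ j h1 h2)) j h1 h2
  · exact ⟨hInFace hPa₀ (hfaceA (show a₀ < n by omega)).1 (hfaceA (show a₀ < n by omega)).2,
      hOutFace hQb₀ (hfaceB (show b₀ ≤ n by omega)).1 (hfaceB (show b₀ ≤ n by omega)).2⟩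
  · exact ⟨hOutFace hPa₁ (hfaceA (show a₁ < n by omega)).1 (hfaceA (show a₁ < n by omega)).2,
      hInFace hQb₁ (hfaceB (show b₁ ≤ n by omega)).1 (hfaceB (show b₁ ≤ n by omega)).2⟩
  · exact ⟨hInFace hPa₂ (hfaceA (show a₂ < n by omega)).1 (hfaceA (show a₂ < n by omega)).2,
      hOutFace hQb₂ (hfaceB (show b₂ ≤ n by omega)).1 (hfaceB (show b₂ ≤ n by omega)).2⟩
  · exact ⟨hOutFace hPa₃ (hfaceA (show a₃ < n by omega)).1 (hfaceA (show a₃ < n by omega)).2,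
      hInFace hQb₃ (hfaceB hb₃).1 (hfaceB hb₃).2⟩

end Literature.Probability.Percolation
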